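import Literature.IUT.LogVolume.DHConductorRamificationThetaData
import Literature.IUT.LogVolume.InitialThetaDataBadPlaceRamification
import HarnessLib

/-!
# Dupuy–Hilado (arXiv:2004.13108v2) Thm 3.9.2 AS PRINTED (the `iff`) HOLDS at an initial Θ-datum whose
# `V^bad_mod` carries all places of bad reduction — the (⟸) half from [IUTchI] Def. 3.1 (c), PROVED

PROOF-ONLY sequel of `DHConductorRamificationThetaData` (T. Dupuy, A. Hilado, arXiv:2004.13108v2
[DupuyHilado2020], UNREFEREED; held render `book:anonnd-2004-13108v2`, locators `p.N l.M`). No new definition,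
no new `Prop` fact. Cited BY NAME: the typed candidate `RamifiedIffConductorOrDifferent` (Thm 3.9.2 AS PRINTED,
`DHExplicitSzpiro`); `InitialThetaData.conductor_le_or_one_lt_ramIdx` (its (⟹) half at `D`),
`conductor_le_of_conductorExponent_ne_zero`, `ramIdx_eq_ramIdx_under_mul` (`DHConductorRamificationThetaData`);
abc-iut-w5-d009's `ThetaData.one_lt_absRamificationIdx_of_under_mem_VFbad` ([IUTchI] Def. 3.1 (c) "`l` prime to
the orders of the `q`-parameters" + Ex. 3.2 (iv): every place of `K` over `V(F)^bad` has `e(w|p) ≥ l ≥ 5`,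
`InitialThetaDataBadPlaceRamification`); `ThetaData.mk_mem_VFbad_iff` (`InitialThetaDataVolume`); Silverman
ATAEC IV.10.2 (a) `WeierstrassCurve.conductorExponent_eq_zero_iff_holds`.

## The printed statement (Thm 3.9.2 p.15 l.27 – p.16 l.4) and its status in the tree

"`e(w/p) > 1 ⟺ w | l` or `w | Cond(A/L)` or `w | Diff(L/ℚ)`" for an abelian variety `A/L` and a place `w ∤ l`
of `L(A[l])`. The (⟹) half is Néron–Ogg–Shafarevich and holds for the `K = F(E_F[l])` of every initial Θ-datum
(`InitialThetaData.conductor_le_or_one_lt_ramIdx`). The (⟸) half as printed (proof p.16 l.2–3: "`v | Cond ⟺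
v` is ramified `⟺ I_{w/v} ≠ 1`") passes from `T_l(A)` to the finite level and FAILS in general (erratum
candidate E-DH-7: a multiplicative `v ∤ l` with `l | ord_v(q_v)` has `F_v(E[l]) = F_v(ζ_l, q_v^{1/l})`
unramified). This file proves that it nevertheless HOLDS in the setting where the paper uses it: for an
initial Θ-datum `D` ([IUTchI] Def. 3.1) whose `V^bad_mod` lies under every place of multiplicative reduction
of `E/F` (print's standing hypothesis §3.8 p.13 l.16–18 / Def. 1.0.1 p.2 l.34, typed `hfull`), because Def. 3.1
(c) makes `l` prime to `ord_v(q_v)` at every `v ∈ V(F)^bad`, so `e(w/p) ≥ l` there (abc-iut-w5-d009).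

## What is PROVED here

* `conductorExponent_ne_zero_of_conductor_le`, `not_hasGoodReductionAt_of_conductor_le` — the converses of
  the `DHConductorRamificationThetaData` lemmas: `𝔣(E/F) ≤ 𝔭_v ⟹ f_v ≠ 0 ⟹ E` is bad at `v` (the conductor
  is the finite product `∏ 𝔭_w^{f_w}` and `𝔭_v` is prime and maximal).
* `one_lt_ramIdx_of_one_lt_ramIdx_under` — `e(v/p) > 1 ⟹ e(w/p) > 1` for `w | v` (`e(w/p) = e(v/p)·e(w/v)`).
* `InitialThetaData.one_lt_ramIdx_of_conductor_le` — **the (⟸) half at `D` under `hfull`**: `w | v`,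
  `𝔣(E/F) ≤ v ⟹ e(w/p) > 1` (indeed `≥ 5`).
* `InitialThetaData.ramifiedIffConductorOrDifferent_of_forall_under_mem` — **Thm 3.9.2 AS PRINTED (the typed
  candidate `RamifiedIffConductorOrDifferent E l` for `D`'s `F ⊆ K`) DISCHARGED at every initial Θ-datum with
  `hfull`.**

HONEST FRAMING: classical (Néron–Ogg–Shafarevich, Tate curve ramification via Def. 3.1 (c)); nothing here bears
on [IUTchIII] Cor. 3.12 [claim: Mochizuki2012, status: disputed]. E-DH-7 stands for the printed generality
(arbitrary abelian variety / arbitrary `l`-division tower); no side is taken on any author. Typed ≠ proved ≠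
endorsed; no abc claim.
-/

noncomputable section

open scoped Classical

namespace Literature.IUT.LogVolume

open NumberField IsDedekindDomain Finset

/-! ## A prime dividing the conductor is a place of bad reduction -/
section Conductor

/-- **`𝔣(E/K) ≤ 𝔭_v ⟹ f_v ≠ 0`** (converse of `conductor_le_of_conductorExponent_ne_zero`): the conductor is
the finite product `∏_w 𝔭_w^{f_w}` over the places with `f_w ≠ 0`; if the prime `𝔭_v` contains it, it
contains some `𝔭_w^{f_w}` with `f_w ≠ 0`, hence `𝔭_w`, hence `w = v` (height-one primes are maximal).
[cite: Silverman1994, IV.10 (definition of the conductor following Thm. 10.2)] -/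
theorem conductorExponent_ne_zero_of_conductor_le {A : Type*} [CommRing A] [IsDedekindDomain A]
    {L : Type*} [Field L] [Algebra A L] [IsFractionRing A L] (W : WeierstrassCurve L) [W.IsElliptic]
    (v : HeightOneSpectrum A) (hv : W.conductor A ≤ v.asIdeal) : W.conductorExponent v ≠ 0 := by
  have hfin : {w : HeightOneSpectrum A | W.conductorExponent w ≠ 0}.Finite :=
    (WeierstrassCurve.finite_setOf_ordMinimalDiscriminant_ne_zero_holds (A := A) W).subset
      fun w hw h => hw (Nat.eq_zero_of_le_zero
        (h ▸ WeierstrassCurve.conductorExponent_le_ordMinimalDiscriminant w W))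
  have hsub : (Function.mulSupport fun w : HeightOneSpectrum A => w.asIdeal ^ W.conductorExponent w) ⊆
      hfin.toFinset := by
    intro w hw
    rw [Function.mem_mulSupport] at hw
    simp only [Set.Finite.coe_toFinset, Set.mem_setOf_eq]
    intro h0
    exact hw (by rw [h0, pow_zero])
  rw [WeierstrassCurve.conductor, finprod_eq_prod_of_mulSupport_subset _ hsub] at hv
  obtain ⟨w, hw, hle⟩ := (Ideal.IsPrime.prod_le v.isPrime).mp hv
  have hfw : W.conductorExponent w ≠ 0 := by simpa using hw
  haveI := v.isPrime
  have hwv : w.asIdeal ≤ v.asIdeal := (Ideal.IsPrime.pow_le_iff hfw).mp hle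
  have heq : w.asIdeal = v.asIdeal := w.isMaximal.eq_of_le v.isPrime.ne_top hwv
  have : w = v := HeightOneSpectrum.ext heq
  rw [← this]
  exact hfw

/-- **A prime dividing the conductor is a place of bad reduction** (number-field case; `f_v = 0 ⟺ good`,
Silverman ATAEC IV.10.2 (a) = tree `conductorExponent_eq_zero_iff_holds`): "`v | Cond(E/F)` ⟹ `E` has bad
reduction at `v`". [cite: Silverman1994, IV.10.2(a)] [cite: DupuyHilado2020, Thm 3.9.2 proof p.16 l.2–3] -/
theorem not_hasGoodReductionAt_of_conductor_le {F : Type*} [Field F] [NumberField F]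
    (E : WeierstrassCurve F) [E.IsElliptic] (v : HeightOneSpectrum (𝓞 F))
    (hv : E.conductor (𝓞 F) ≤ v.asIdeal) : ¬ E.HasGoodReductionAt v := by
  haveI : Finite (IsLocalRing.ResidueField (v.adicCompletionIntegers F)) :=
    HeightOneSpectrum.finite_residueField_adicCompletionIntegers F v
  intro hgood
  exact conductorExponent_ne_zero_of_conductor_le E v hv
    ((WeierstrassCurve.conductorExponent_eq_zero_iff_holds v E).mpr hgood)

end Conductor

/-! ## `e(v/p) > 1 ⟹ e(w/p) > 1` -/
section Tower

variable {F : Type*} [Field F] [NumberField F] (K : Type*) [Field K] [NumberField K] [Algebra F K]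

/-- "`w | Diff(F/ℚ)` ⟹ `e(w/p) > 1`": for `w | v`, `e(w/p) = e(v/p)·e(w/v) ≥ e(v/p)` (`e(w/v) ≥ 1`).
[cite: DupuyHilado2020, Thm 3.9.2 proof p.15 l.31–32] -/
theorem one_lt_ramIdx_of_one_lt_ramIdx_under (w : HeightOneSpectrum (𝓞 K)) (v : HeightOneSpectrum (𝓞 F))
    (hv : w.asIdeal.under (𝓞 F) = v.asIdeal) (h : 1 < ramIdx F v) : 1 < ramIdx K w := by
  have hmul := ramIdx_eq_ramIdx_under_mul K w v hv
  have hK := ramIdx_ne_zero K w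
  have he : w.asIdeal.ramificationIdx (𝓞 F) ≠ 0 := by
    intro h0
    rw [h0, mul_zero] at hmul
    exact hK hmul
  rw [hmul]
  calc 1 < ramIdx F v := h
    _ = ramIdx F v * 1 := (mul_one _).symm
    _ ≤ ramIdx F v * w.asIdeal.ramificationIdx (𝓞 F) :=
        Nat.mul_le_mul_left _ (Nat.one_le_iff_ne_zero.mpr he)

end Tower

/-! ## The (⟸) half at an initial Θ-datum with `V^bad_mod` under every bad place -/

namespace ExplicitSzpiro

open Literature.IUT.HodgeTheaters

variable {F K Fbar : Type} [Field F] [NumberField F] [Field K] [NumberField K] [Algebra F K]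
  [Field Fbar] [Algebra F Fbar] [Algebra K Fbar]
  {E : WeierstrassCurve F} [E.IsElliptic] {l : ℕ} {Pb : BadPlacePredicates K}

/-- **Thm 3.9.2, the (⟸) half at the conductor, AT an initial Θ-datum with `V^bad_mod` under every place of
multiplicative reduction (`hfull`) — PROVED**: for `w | v` with `𝔣(E/F) ≤ v`, `e(w/p) > 1`. Route: `𝔣 ≤ v ⟹ E`
bad at `v` (`not_hasGoodReductionAt_of_conductor_le`), hence multiplicative (`D.isSemistable`), hence `v` lies
over `V^bad_mod` (`hfull`), i.e. `v ∈ V(F)^bad` (`ThetaData.mk_mem_VFbad_iff`), where [IUTchI] Def. 3.1 (c) + Ex.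
3.2 (iv) give `e(w|p) ≥ l ≥ 5` (abc-iut-w5-d009's `ThetaData.one_lt_absRamificationIdx_of_under_mem_VFbad`).
In print (p.16 l.2–3) this direction is asserted for any abelian variety and fails in that generality
(E-DH-7); here it is established in the setting of use. [cite: DupuyHilado2020, Thm 3.9.2 p.15 l.27 – p.16 l.4]
[cite: Mochizuki2012, IUTchI Def. 3.1 (c) p. 62; Ex. 3.2 (iv) p. 71] -/
theorem _root_.Literature.IUT.HodgeTheaters.InitialThetaData.one_lt_ramIdx_of_conductor_le
    (D : InitialThetaData F K Fbar E l Pb)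
    (hfull : ∀ x : HeightOneSpectrum (𝓞 F), E.HasMultiplicativeReductionAt x →
      x.under (𝓞 (fieldOfModuli E)) ∈ ThetaData.badPrimesMod D)
    (w : HeightOneSpectrum (𝓞 K)) (v : HeightOneSpectrum (𝓞 F)) (hv : w.asIdeal.under (𝓞 F) = v.asIdeal)
    (hcond : E.conductor (𝓞 F) ≤ v.asIdeal) : 1 < ramIdx K w := by
  have hbad := not_hasGoodReductionAt_of_conductor_le E v hcond
  have hmult : E.HasMultiplicativeReductionAt v := (D.isSemistable v).resolve_left hbad
  have hvw : w.under (𝓞 F) = v := HeightOneSpectrum.ext (by rw [HeightOneSpectrum.under_asIdeal, hv])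
  have hmem : FinitePlace.mk (w.under (𝓞 F)) ∈ D.VFbad := by
    rw [ThetaData.mk_mem_VFbad_iff D, hvw]
    exact hfull v hmult
  have h1 := ThetaData.one_lt_absRamificationIdx_of_under_mem_VFbad D hmem
  have hK : ramIdx K w = w.asIdeal.ramificationIdx ℤ := by
    unfold ramIdx
    exact Ideal.ramificationIdx'_eq_ramificationIdx (p := Ideal.span {(residueChar K w : ℤ)})
      (q := w.asIdeal) (by simp [(residueChar_prime K w).ne_zero])
  rw [hK]
  exact h1

/-- **Thm 3.9.2 AS PRINTED — the typed candidate `RamifiedIffConductorOrDifferent E l` for the tower `F ⊆ K =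
F(E_F[l])` — DISCHARGED at every initial Θ-datum with `V^bad_mod` under every place of multiplicative reduction
(`hfull`)**: for a finite place `w` of `K` over `v`, coprime to `l`, `e(w/p) > 1 ⟺ 𝔣(E/F) ≤ v ∨ e(v/p) > 1`.
(⟹): Néron–Ogg–Shafarevich (`InitialThetaData.conductor_le_or_one_lt_ramIdx`); (⟸): Def. 3.1 (c) at the
conductor (`one_lt_ramIdx_of_conductor_le`) and multiplicativity of `e` at the different
(`one_lt_ramIdx_of_one_lt_ramIdx_under`). [cite: DupuyHilado2020, Thm 3.9.2 p.15 l.27 – p.16 l.4]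
[cite: Mochizuki2012, IUTchI Def. 3.1 (c) p. 62] -/
theorem _root_.Literature.IUT.HodgeTheaters.InitialThetaData.ramifiedIffConductorOrDifferent_of_forall_under_mem
    (D : InitialThetaData F K Fbar E l Pb)
    (hfull : ∀ x : HeightOneSpectrum (𝓞 F), E.HasMultiplicativeReductionAt x →
      x.under (𝓞 (fieldOfModuli E)) ∈ ThetaData.badPrimesMod D) :
    RamifiedIffConductorOrDifferent (K := K) E l := by
  intro w v hv hne
  constructor
  · exact D.conductor_le_or_one_lt_ramIdx w v hv hne
  · rintro (hcond | hram)
    · exact D.one_lt_ramIdx_of_conductor_le hfull w v hv hcond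
    · exact one_lt_ramIdx_of_one_lt_ramIdx_under K w v hv hram

end ExplicitSzpiro

end Literature.IUT.LogVolume

end
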